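import Mathlib
import Summits.HodgeConjecture.HodgeConjecture.Theorems.Ring2AbelianAllNonsplitNormObstruction
import HarnessLib

/-!
# The box-frame dichotomy: `X S = S Xᵀ` for all symmetric off-block `S` forces `X` scalar,
# and an equal-weight frame forces `disc θ ∈ Nm ℚ(√-3)ˣ ∌ 2` (WEIL-2 gen 24, THEOREM BOX)

research route, not a corollary; conditional on HC_CM plus one named minimal statement.

Cell `pub-hodge-ring2-ab-*` (ALL ABELIAN VARIETIES), seat WEIL-2 gen 24, §5.3 (THEOREM BOX) of
`run/shared/lean/pub/pub-hodge-ring2/pub-hodge-ring2-ab-weil-2/FLAT-G24.md`.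

Setting (informal; nothing of it is formalised here).  On the CM sixfold `Y₀ = E_ω⁶` with the
Weil structure of the non-split `(ℚ(√-3), (3,3))` component (polarisation `θ = diag(1,1,1,1,1,2)`),
a FRAME is a basis `a₁, …, a₆` of `K⁶` by elliptic quotients `y_t = Σ a_{t,i} z_i`, with fibre classes
`D_t = a_t a_t^*`.  The parity-folded Koszul two-term design of the frame passes the first-order
«transport» test along the tangent space `T S = {k off-block : θ k symmetric}` of the Weil family only
if `N k` is symmetric for every `k ∈ T S`, where `N = Σ_t D_t` (FLAT-G24 5.3 (i)).  Writing
`X := N θ⁻¹` and `S := θ k`, the set `{θ k : k ∈ T S}` is exactly the set of symmetric matrices with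
zero diagonal blocks, `S = [[0, B], [Bᵀ, 0]]`, and the condition becomes `X S = S Xᵀ` for all such `S`.

This file proves the two algebraic facts that turn this into the dichotomy «split only»:

* `eq_zero_of_forall_mul_transpose_comm` — a square block `P` with `P Bᵀ = B Pᵀ` for ALL `B` is zero
  (as soon as the index type has two elements); `exists_scalar_of_forall_mul_comm` — `X B = B Y` for
  all `B` forces `X = Y = c·1`; `fromBlocks_scalar_of_forall_offblock` — hence
  `X S = S Xᵀ` for all symmetric off-block `S` forces `X = c·1`, i.e. `Σ_t D_t = c·θ`: the frame is
  `θ⁻¹`-orthogonal with EQUAL weights (THEOREM BOX (ii));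
* `two_ne_pow_six_mul_norm3` — then `det θ = c⁻⁶ · Nm_{K/ℚ}(det M)`, and `2 = λ⁶ (a² + 3 b²)` has no
  rational solution (THEOREM BOX (iii); from the tree's `not_exists_sq_add_three_sq_eq_two`, p301193:
  `2 ∉ Nm ℚ(√-3)ˣ`): no frame of the non-split cell has equal weights, so no folded Koszul box in
  the cell passes the first-order test — while on the split sibling the isotropic frame
  `{e_i ± e_{i+3}}` does (engine, FLAT-G24 5.2 (d)).

0 sorry, no `def`, no named fact; `HC_CM` does not occur.

## References

* [MumfordAV1970] D. Mumford, Abelian Varieties, §16, §20 (Riemann form, degree/Pfaffian)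
  — context for `det θ` as the discriminant of the polarisation; not re-proved here.
* [vanGeemen1994HodgeAV] B. van Geemen, An introduction to the Hodge conjecture for abelian
  varieties, LNM 1594, §5 (the discriminant of a Weil-type hermitian form as a class in `ℚˣ/Nm Kˣ`).
-/

namespace Summit.HodgeConjecture.Ring2AbelianAll.NonsplitBoxFrame

open Matrix

variable {K : Type*} [Field K] {n : Type*} [Fintype n] [DecidableEq n]

/-- **Off-block lemma.** If `P * Bᵀ = B * Pᵀ` for every square matrix `B`, and the index type has
two distinct elements, then `P = 0`.  (Test against `B = single i j 1` with `i` different from the row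
being read: the `(a,i)` entry of `P Bᵀ` is `P a j`, that of `B Pᵀ` is `0`.)
research route, not a corollary; conditional on HC_CM plus one named minimal statement.
[locator FLAT-G24 §5.3 THEOREM BOX (ii); linear algebra] -/
theorem eq_zero_of_forall_mul_transpose_comm (P : Matrix n n K)
    (h : ∀ B : Matrix n n K, P * Bᵀ = B * Pᵀ) (hn : ∃ i₀ j₀ : n, i₀ ≠ j₀) : P = 0 := by
  obtain ⟨i₀, j₀, hij⟩ := hn
  ext a j
  -- choose an index `i ≠ a`
  obtain ⟨i, hi⟩ : ∃ i : n, a ≠ i := by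
    by_cases ha : a = i₀
    · exact ⟨j₀, by rw [ha]; exact hij⟩
    · exact ⟨i₀, ha⟩
  have hB := h (single i j 1)
  have hEntry := congrFun (congrFun hB a) i
  rw [transpose_single, mul_single_apply_same, single_mul_apply_of_ne (h := hi)] at hEntry
  simpa using hEntry

/-- **Diagonal-block lemma.** If `X * B = B * Y` for every `B` then `X = Y` and `X` is a scalar matrix.
research route, not a corollary; conditional on HC_CM plus one named minimal statement.
[locator FLAT-G24 §5.3 THEOREM BOX (ii); linear algebra] -/
theorem exists_scalar_of_forall_mul_comm (X Y : Matrix n n K)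
    (h : ∀ B : Matrix n n K, X * B = B * Y) :
    ∃ c : K, X = Matrix.scalar n c ∧ Y = Matrix.scalar n c := by
  have hXY : X = Y := by simpa using h 1
  subst hXY
  have hcomm : Pairwise fun i j => Commute (single i j (1 : K)) X :=
    fun i j _ => (h (single i j 1)).symm
  obtain ⟨c, hc⟩ := mem_range_scalar_of_commute_single hcomm
  exact ⟨c, hc.symm, hc.symm⟩

/-- **THEOREM BOX (ii), matrix form.** Let `X` be a block matrix on `n ⊕ n` (`n` with at least two
elements).  If `X S = S Xᵀ` for every symmetric off-block `S = fromBlocks 0 B Bᵀ 0`, then `X` is a scalar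
matrix.  With `X = N θ⁻¹` (`N = Σ_t D_t` the sum of the fibre classes of a frame, `θ` the polarisation)
this says: the folded Koszul box of the frame passes the `|S| = 2` transport conditions only if
`Σ_t D_t = c·θ` — the frame is `θ⁻¹`-orthogonal with equal weights.
research route, not a corollary; conditional on HC_CM plus one named minimal statement.
[locator FLAT-G24 §5.3 THEOREM BOX (ii)] -/
theorem fromBlocks_scalar_of_forall_offblock (X₁₁ X₁₂ X₂₁ X₂₂ : Matrix n n K)
    (h : ∀ B : Matrix n n K,
      fromBlocks X₁₁ X₁₂ X₂₁ X₂₂ * fromBlocks 0 B Bᵀ 0 =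
        fromBlocks 0 B Bᵀ 0 * (fromBlocks X₁₁ X₁₂ X₂₁ X₂₂)ᵀ)
    (hn : ∃ i₀ j₀ : n, i₀ ≠ j₀) :
    ∃ c : K, X₁₁ = Matrix.scalar n c ∧ X₂₂ = Matrix.scalar n c ∧ X₁₂ = 0 ∧ X₂₁ = 0 := by
  have hblocks : ∀ B : Matrix n n K,
      X₁₂ * Bᵀ = B * X₁₂ᵀ ∧ X₁₁ * B = B * X₂₂ᵀ ∧ X₂₂ * Bᵀ = Bᵀ * X₁₁ᵀ ∧ X₂₁ * B = Bᵀ * X₂₁ᵀ := by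
    intro B
    have hB := h B
    rw [fromBlocks_transpose, fromBlocks_multiply, fromBlocks_multiply] at hB
    simp only [Matrix.mul_zero, Matrix.zero_mul, zero_add, add_zero] at hB
    obtain ⟨h11, h12, h21, h22⟩ := fromBlocks_inj.mp hB
    exact ⟨h11, h12, h21, h22⟩
  -- off-diagonal blocks vanish
  have h12 : X₁₂ = 0 :=
    eq_zero_of_forall_mul_transpose_comm X₁₂ (fun B => (hblocks B).1) hn
  have h21 : X₂₁ = 0 := by
    refine eq_zero_of_forall_mul_transpose_comm X₂₁ (fun B => ?_) hn
    have := (hblocks Bᵀ).2.2.2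
    simpa using this
  -- diagonal blocks are equal scalars
  obtain ⟨c, hc1, hc2⟩ := exists_scalar_of_forall_mul_comm X₁₁ X₂₂ᵀ (fun B => (hblocks B).2.1)
  refine ⟨c, hc1, ?_, h12, h21⟩
  have := congrArg Matrix.transpose hc2
  simpa using this

/-- **THEOREM BOX (iii), arithmetic form.** `2 ≠ λ⁶ · (a² + 3 b²)` for rationals `λ, a, b`: if a frame
of the cell had equal weights, `θ = λ · Mᵀ M̄` would give `det θ = 2 = λ⁶ · Nm_{ℚ(√-3)/ℚ}(det M)`,
i.e. `2 = (λ³ a)² + 3 (λ³ b)²`, contradicting `2 ∉ Nm ℚ(√-3)ˣ`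
(`NonsplitNormObstruction.not_exists_sq_add_three_sq_eq_two`, p301193).  On the split sibling
(`det θ = 1`) equal-weight frames exist (`e_i ± e_{i+3}`, `λ = 1/2`, `det M = -8`: `1 = 2⁻⁶·64`).
research route, not a corollary; conditional on HC_CM plus one named minimal statement.
[tree: NonsplitNormObstruction.not_exists_sq_add_three_sq_eq_two (p301193); locator FLAT-G24 §5.3 (iii)] -/
theorem two_ne_pow_six_mul_norm3 (c a b : ℚ) : (2 : ℚ) ≠ c ^ 6 * (a ^ 2 + 3 * b ^ 2) := by
  intro h
  apply Summit.HodgeConjecture.Ring2AbelianAll.NonsplitNormObstruction.not_exists_sq_add_three_sq_eq_two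
  exact ⟨c ^ 3 * a, c ^ 3 * b, by rw [h]; ring⟩

/-- The split control in numbers: with `λ = 1/2` and `det M = -8` (the frame `e_i ± e_{i+3}`),
`λ⁶ · Nm(det M) = 2⁻⁶ · 64 = 1 = det θ_split`.
research route, not a corollary; conditional on HC_CM plus one named minimal statement.
[locator FLAT-G24 §5.2 (d); arithmetic] -/
theorem split_equal_weight_frame_check : ((1 : ℚ) / 2) ^ 6 * ((-8 : ℚ) ^ 2 + 3 * 0 ^ 2) = 1 := by
  norm_num

end Summit.HodgeConjecture.Ring2AbelianAll.NonsplitBoxFrame
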